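import Summits.CriticalPhenomena.PercolationContinuityZ3.Theorems.SahiMasterFamilyFCombPeelable
import Mathlib.Algebra.BigOperators.Fin
import Mathlib.Tactic.Linarith
import HarnessLib

/-!
# The comb form of the `F`-inequality: Kleitman's lemma, third events without complementary pairs, and ALL THRESHOLD events

Support file (cell `prim-bnk`, seat bnk-2 gen 20; `--supports stmt-CriticalPhenomena-4575`; memo
`run/shared/lean/prim/prim-l12/FROM-prim-bnk-2-g20-CP-CERTIFICATES.md`, §4 Remark (iv) / §6(c)).  One definition (the inductive class
`PeelableNP`, = `Peelable` with one more base case), no `sorry`, standard axioms.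

Events on the cube `Fin n → Bool` are Boolean indicator functions; `x̄ = fun i => !x i`; the comb form (top tensor-Bernstein coefficient of
`F(A,B;G) = (1+μG)μ(ABG) − μG·μ(AB) − μ(AG)μ(BG)`) is `K(A,B,G) = #{x∈ABG} − #{x∈AG : x̄∈BG} − #{x∈G : x̄∈AB∖G}`.  THIS FILE PROVES

* `kleitman_sum_nonneg` — **Kleitman's lemma in top-coefficient form**: `#{x ∈ X∩G} ≥ #{x ∈ X : x̄ ∈ G}` for monotone `X, G`
  (induction along a coordinate; the cross term is `(X(y1)−X(y0))(G(ȳ1)−G(ȳ0)) ≥ 0` pointwise).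
* `comb_sum_nonneg_of_noPair` — if `G` contains NO complementary pair (`¬(x ∈ G ∧ x̄ ∈ G)`, e.g. every majority and every `G` inside a
  maximal intersecting family) then `K(A,B,G) = #{x∈ABG} − #{x∈AB : x̄∈G} ≥ 0` for all monotone `A, B` (Kleitman with `X = A∩B`).
* `PeelableNP` = the recursively peelable class of `…FCombPeelable` with the extra base case "no complementary pair", and
  `comb_sum_nonneg_of_peelableNP`.
* **`comb_sum_nonneg_threshold`: `K(A,B,G) ≥ 0` for all monotone `A, B` and EVERY THRESHOLD EVENT `G = {x : #{i : x i} ≥ t}`, all `n, t`**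
  (`peelableNP_threshold`: along any coordinate a threshold event has a doubly-pivotal antipodal pair only in the majority case `n = 2t−1`,
  and a majority event contains no complementary pair; sections of thresholds are thresholds).

Since restrictions of threshold events to faces are threshold events, every tensor-Bernstein coefficient of `F(A,B;G)` is `≥ 0`, i.e.
**`F(A,B;G) ≥ 0` for all increasing `A, B` and every product measure whenever `G` is a threshold (in particular majority) event** (memo;
the Bernstein-expansion bookkeeping is not formalised here).  HONEST FRAMING: comb inequality for these classes; `F ≥ 0` in general OPEN. [this work]
-/

namespace Summit.CriticalPhenomena.PercolationContinuityZ3.Theorems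

namespace SahiFComb

open Finset

variable {n : ℕ}

/-! ### 1. Kleitman's lemma, top-coefficient form -/

/-- The eight-Boolean inequality behind Kleitman's induction step: `(x1 − x0)(g1' − g0') ≥ 0`. [folklore] -/
theorem kleitman_pair_nonneg : ∀ (x0 x1 g0 g1 x0' x1' g0' g1' : Bool),
    (x0 = true → x1 = true) → (g0' = true → g1' = true) →
    0 ≤ ( (((Bool.toNat (x0 && g0) : ℕ) : ℤ) - ((Bool.toNat (x0 && g1') : ℕ) : ℤ))
        + (((Bool.toNat (x1 && g1) : ℕ) : ℤ) - ((Bool.toNat (x1 && g0') : ℕ) : ℤ)) )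
        - ( (((Bool.toNat (x0 && g0) : ℕ) : ℤ) - ((Bool.toNat (x0 && g0') : ℕ) : ℤ))
          + (((Bool.toNat (x1 && g1) : ℕ) : ℤ) - ((Bool.toNat (x1 && g1') : ℕ) : ℤ)) ) := by
  decide

/-- Kleitman's lemma, sectioning step: the top-coefficient form of the big cube dominates the sum over the two sections. [folklore] -/
theorem kleitman_sum_ge_sections (e : Fin (n + 1)) (X G : (Fin (n + 1) → Bool) → Bool)
    (hX : ∀ y, X (Fin.insertNth e false y) = true → X (Fin.insertNth e true y) = true)
    (hG : ∀ y, G (Fin.insertNth e false y) = true → G (Fin.insertNth e true y) = true) :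
    (∑ y : Fin n → Bool, (((Bool.toNat (X (Fin.insertNth e false y) && G (Fin.insertNth e false y)) : ℕ) : ℤ)
        - ((Bool.toNat (X (Fin.insertNth e false y) && G (Fin.insertNth e false (fun j => !y j))) : ℕ) : ℤ)))
    + (∑ y : Fin n → Bool, (((Bool.toNat (X (Fin.insertNth e true y) && G (Fin.insertNth e true y)) : ℕ) : ℤ)
        - ((Bool.toNat (X (Fin.insertNth e true y) && G (Fin.insertNth e true (fun j => !y j))) : ℕ) : ℤ)))
    ≤ ∑ x : Fin (n + 1) → Bool, (((Bool.toNat (X x && G x) : ℕ) : ℤ) - ((Bool.toNat (X x && G (fun i => !x i)) : ℕ) : ℤ)) := by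
  rw [sum_cube_split e]
  have h0 : ∀ y : Fin n → Bool, (fun i => !(Fin.insertNth (α := fun _ => Bool) e false y i)) =
      Fin.insertNth (α := fun _ => Bool) e true (fun j => !y j) :=
    fun y => by simpa using antipode_insertNth e false y
  have h1 : ∀ y : Fin n → Bool, (fun i => !(Fin.insertNth (α := fun _ => Bool) e true y i)) =
      Fin.insertNth (α := fun _ => Bool) e false (fun j => !y j) :=
    fun y => by simpa using antipode_insertNth e true y
  simp only [h0, h1]
  rw [← sub_nonneg, ← Finset.sum_add_distrib, ← Finset.sum_sub_distrib]
  refine Finset.sum_nonneg (fun y _ => ?_)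
  have key := kleitman_pair_nonneg (X (Fin.insertNth e false y)) (X (Fin.insertNth e true y))
    (G (Fin.insertNth e false y)) (G (Fin.insertNth e true y))
    (X (Fin.insertNth e false (fun j => !y j))) (X (Fin.insertNth e true (fun j => !y j)))
    (G (Fin.insertNth e false (fun j => !y j))) (G (Fin.insertNth e true (fun j => !y j)))
    (hX y) (hG _)
  linarith [key]

/-- **Kleitman's lemma (top tensor-Bernstein coefficient of Harris' inequality).**  For monotone `X, G` on `Fin n → Bool`,
`#{x ∈ X ∩ G} ≥ #{x ∈ X : x̄ ∈ G}`. [folklore] -/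
theorem kleitman_sum_nonneg : ∀ (n : ℕ) (X G : (Fin n → Bool) → Bool), Monotone X → Monotone G →
    0 ≤ ∑ x : Fin n → Bool, (((Bool.toNat (X x && G x) : ℕ) : ℤ) - ((Bool.toNat (X x && G (fun i => !x i)) : ℕ) : ℤ))
  | 0, X, G, _, _ => by
      refine Finset.sum_nonneg (fun x _ => ?_)
      have hx : (fun i => !x i) = x := by funext i; exact Fin.elim0 i
      rw [hx]; simp
  | (n + 1), X, G, hX, hG => by
      have step := kleitman_sum_ge_sections 0 X G (mono_along 0 hX) (mono_along 0 hG)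
      have i0 := kleitman_sum_nonneg n _ _ (mono_section 0 false hX) (mono_section 0 false hG)
      have i1 := kleitman_sum_nonneg n _ _ (mono_section 0 true hX) (mono_section 0 true hG)
      linarith

/-! ### 2. Third events without complementary pairs -/

/-- **No complementary pair.**  If the monotone event `G` never contains a point together with its antipode, then for all monotone
`A, B` the comb form reduces to `#{x∈ABG} − #{x∈AB : x̄∈G}`, which is nonnegative by Kleitman's lemma. [this work] -/
theorem comb_sum_nonneg_of_noPair (A B G : (Fin n → Bool) → Bool) (hA : Monotone A) (hB : Monotone B) (hG : Monotone G)
    (hnp : ∀ x : Fin n → Bool, ¬ (G x = true ∧ G (fun i => !x i) = true)) :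
    0 ≤ ∑ x : Fin n → Bool, (((Bool.toNat (A x && B x && G x) : ℕ) : ℤ)
          - ((Bool.toNat (A x && G x && B (fun i => !x i) && G (fun i => !x i)) : ℕ) : ℤ)
          - ((Bool.toNat (G x && A (fun i => !x i) && B (fun i => !x i) && !(G (fun i => !x i))) : ℕ) : ℤ)) := by
  -- pointwise simplification using the absence of complementary pairs
  have hpt : ∀ x : Fin n → Bool,
      (((Bool.toNat (A x && B x && G x) : ℕ) : ℤ)
        - ((Bool.toNat (A x && G x && B (fun i => !x i) && G (fun i => !x i)) : ℕ) : ℤ)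
        - ((Bool.toNat (G x && A (fun i => !x i) && B (fun i => !x i) && !(G (fun i => !x i))) : ℕ) : ℤ))
      = (((Bool.toNat ((A x && B x) && G x) : ℕ) : ℤ)
        - ((Bool.toNat ((A (fun i => !x i) && B (fun i => !x i)) && G x) : ℕ) : ℤ)) := by
    intro x
    have h := hnp x
    revert h
    cases A x <;> cases B x <;> cases G x <;> cases A (fun i => !x i) <;> cases B (fun i => !x i) <;>
      cases G (fun i => !x i) <;> simp
  rw [Finset.sum_congr rfl (fun x _ => hpt x), Finset.sum_sub_distrib]
  -- re-index the second sum by the antipode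
  have hre : ∑ x : Fin n → Bool, ((Bool.toNat ((A (fun i => !x i) && B (fun i => !x i)) && G x) : ℕ) : ℤ)
      = ∑ x : Fin n → Bool, ((Bool.toNat ((A x && B x) && G (fun i => !x i)) : ℕ) : ℤ) := by
    rw [← sum_antipode (fun x => ((Bool.toNat ((A x && B x) && G (fun i => !x i)) : ℕ) : ℤ))]
    refine Finset.sum_congr rfl (fun x _ => ?_)
    have hx : (fun i => !(fun i => !x i) i) = x := by funext i; simp
    simp only [hx]
  rw [hre, ← Finset.sum_sub_distrib]
  have hU : Monotone (fun x => A x && B x) := by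
    intro x y hxy
    have ha := hA hxy; have hb := hB hxy
    show (A x && B x) ≤ (A y && B y)
    revert ha hb
    cases A x <;> cases A y <;> cases B x <;> cases B y <;> simp
  exact kleitman_sum_nonneg n (fun x => A x && B x) G hU hG

/-! ### 3. The peelable class with the extra base case -/

/-- `PeelableNP n G`: like `Peelable`, with the additional base case "`G` is monotone and contains no complementary pair". [this work] -/
inductive PeelableNP : (n : ℕ) → ((Fin n → Bool) → Bool) → Prop
  | zero (G : (Fin 0 → Bool) → Bool) : PeelableNP 0 G
  | one (G : (Fin 1 → Bool) → Bool)
      (hmono : ∀ y : Fin 0 → Bool, G (Fin.insertNth 0 false y) = true → G (Fin.insertNth 0 true y) = true) :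
      PeelableNP 1 G
  | noPair {n : ℕ} (G : (Fin n → Bool) → Bool) (hmono : Monotone G)
      (hnp : ∀ x : Fin n → Bool, ¬ (G x = true ∧ G (fun i => !x i) = true)) : PeelableNP n G
  | step {n : ℕ} (G : (Fin (n + 1) → Bool) → Bool) (e : Fin (n + 1))
      (hmono : ∀ y : Fin n → Bool, G (Fin.insertNth e false y) = true → G (Fin.insertNth e true y) = true)
      (hPi : ∀ y : Fin n → Bool, ¬ (G (Fin.insertNth e true y) = true ∧ G (Fin.insertNth e false y) = false ∧
              G (Fin.insertNth e true (fun j => !y j)) = true ∧ G (Fin.insertNth e false (fun j => !y j)) = false))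
      (h0 : PeelableNP n (fun y => G (Fin.insertNth e false y)))
      (h1 : PeelableNP n (fun y => G (Fin.insertNth e true y))) : PeelableNP (n + 1) G

/-- The comb form is nonnegative on the class `PeelableNP`. [this work] -/
theorem comb_sum_nonneg_of_peelableNP {n : ℕ} {G : (Fin n → Bool) → Bool} (hP : PeelableNP n G) :
    ∀ (A B : (Fin n → Bool) → Bool), Monotone A → Monotone B →
      0 ≤ ∑ x : Fin n → Bool, (((Bool.toNat (A x && B x && G x) : ℕ) : ℤ)
            - ((Bool.toNat (A x && G x && B (fun i => !x i) && G (fun i => !x i)) : ℕ) : ℤ)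
            - ((Bool.toNat (G x && A (fun i => !x i) && B (fun i => !x i) && !(G (fun i => !x i))) : ℕ) : ℤ)) := by
  induction hP with
  | zero G =>
      intro A B _ _
      exact comb_sum_nonneg_zero A B G
  | one G hmono =>
      intro A B hA hB
      exact comb_sum_nonneg_one A B G (mono_along 0 hA) (mono_along 0 hB) hmono
  | noPair G hmono hnp =>
      intro A B hA hB
      exact comb_sum_nonneg_of_noPair A B G hA hB hmono hnp
  | step G e hmono hPi h0 h1 ih0 ih1 =>
      intro A B hA hB
      have step := comb_sum_ge_sections e A B G (mono_along e hA) (mono_along e hB) hmono hPi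
      have i0 := ih0 (fun y => A (Fin.insertNth e false y)) (fun y => B (Fin.insertNth e false y))
        (mono_section e false hA) (mono_section e false hB)
      have i1 := ih1 (fun y => A (Fin.insertNth e true y)) (fun y => B (Fin.insertNth e true y))
        (mono_section e true hA) (mono_section e true hB)
      linarith

/-! ### 4. Threshold events -/

/-- Counting the `true` coordinates of an inserted tuple. [folklore] -/
theorem cnt_insertNth (e : Fin (n + 1)) (s : Bool) (y : Fin n → Bool) :
    (∑ i, Bool.toNat (Fin.insertNth (α := fun _ => Bool) e s y i)) = Bool.toNat s + ∑ j, Bool.toNat (y j) := by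
  rw [Fin.sum_univ_succAbove _ e]
  simp [Fin.insertNth_apply_same, Fin.insertNth_apply_succAbove]

/-- Counting the `true` coordinates of the antipode. [folklore] -/
theorem cnt_antipode (x : Fin n → Bool) :
    (∑ i, Bool.toNat (!x i)) + ∑ i, Bool.toNat (x i) = n := by
  rw [← Finset.sum_add_distrib]
  have : ∀ i : Fin n, Bool.toNat (!x i) + Bool.toNat (x i) = 1 := fun i => by cases x i <;> rfl
  simp [this]

/-- **Threshold events are recursively peelable** (with the no-pair base): the event `#{i : x i} ≥ t` on `Fin n → Bool`, all `n, t`.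
Along any coordinate a threshold is doubly pivotal on an antipodal pair only if `n = 2t − 1` (majority), and a majority event contains
no complementary pair. [this work] -/
theorem peelableNP_threshold : ∀ (n t : ℕ), PeelableNP n (fun x : Fin n → Bool => decide (t ≤ ∑ i, Bool.toNat (x i)))
  | 0, t => PeelableNP.zero _
  | (n + 1), t => by
      by_cases hmaj : 1 ≤ t ∧ n + 2 = 2 * t
      · -- majority: no complementary pair
        refine PeelableNP.noPair _ (fun x y hxy => ?_) (fun x => ?_)
        · -- monotone
          have hle : (∑ i, Bool.toNat (x i)) ≤ ∑ i, Bool.toNat (y i) :=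
            Finset.sum_le_sum (fun i _ => by
              have := hxy i; revert this; cases x i <;> cases y i <;> simp)
          by_cases h : t ≤ ∑ i, Bool.toNat (x i)
          · have h' : t ≤ ∑ i, Bool.toNat (y i) := le_trans h hle
            simp [h, h']
          · simp [h]
        · rintro ⟨h1, h2⟩
          have h1' : t ≤ ∑ i, Bool.toNat (x i) := by simpa using h1
          have h2' : t ≤ ∑ i, Bool.toNat (!x i) := by simpa using h2
          have hc := cnt_antipode x
          omega
      · -- not a majority: peel coordinate 0; it has no doubly-pivotal antipodal pair
        refine PeelableNP.step _ 0 (fun y h => ?_) (fun y => ?_) ?_ ?_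
        · -- increasing along the coordinate
          have h' : t ≤ ∑ i, Bool.toNat (Fin.insertNth (α := fun _ => Bool) 0 false y i) := by simpa using h
          have goal : t ≤ ∑ i, Bool.toNat (Fin.insertNth (α := fun _ => Bool) 0 true y i) := by
            rw [cnt_insertNth] at h' ⊢; simp at h' ⊢; omega
          simpa using goal
        · rintro ⟨h1, h0, h1', h0'⟩
          have a1 : t ≤ ∑ i, Bool.toNat (Fin.insertNth (α := fun _ => Bool) 0 true y i) := by simpa using h1
          have a0 : ¬ t ≤ ∑ i, Bool.toNat (Fin.insertNth (α := fun _ => Bool) 0 false y i) := by simpa using h0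
          have b1 : t ≤ ∑ i, Bool.toNat (Fin.insertNth (α := fun _ => Bool) 0 true (fun j => !y j) i) := by simpa using h1'
          have b0 : ¬ t ≤ ∑ i, Bool.toNat (Fin.insertNth (α := fun _ => Bool) 0 false (fun j => !y j) i) := by simpa using h0'
          rw [cnt_insertNth] at a1 a0 b1 b0
          simp only [Bool.toNat_true, Bool.toNat_false, zero_add] at a1 a0 b1 b0
          have hc := cnt_antipode y
          omega
        · have hsec : (fun y : Fin n → Bool => decide (t ≤ ∑ i, Bool.toNat (Fin.insertNth (α := fun _ => Bool) 0 false y i)))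
              = (fun y : Fin n → Bool => decide (t ≤ ∑ j, Bool.toNat (y j))) := by
            funext y; rw [cnt_insertNth]; simp only [Bool.toNat_false, zero_add]
          show PeelableNP n (fun y : Fin n → Bool => decide (t ≤ ∑ i, Bool.toNat (Fin.insertNth (α := fun _ => Bool) 0 false y i)))
          rw [hsec]
          exact peelableNP_threshold n t
        · have hsec : (fun y : Fin n → Bool => decide (t ≤ ∑ i, Bool.toNat (Fin.insertNth (α := fun _ => Bool) 0 true y i)))
              = (fun y : Fin n → Bool => decide ((t - 1) ≤ ∑ j, Bool.toNat (y j))) := by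
            funext y; rw [cnt_insertNth]; simp only [Bool.toNat_true]
            by_cases h : t - 1 ≤ ∑ j, Bool.toNat (y j)
            · have h2 : t ≤ 1 + ∑ j, Bool.toNat (y j) := by omega
              simp [h, h2]
            · have h2 : ¬ t ≤ 1 + ∑ j, Bool.toNat (y j) := by omega
              simp [h, h2]
          show PeelableNP n (fun y : Fin n → Bool => decide (t ≤ ∑ i, Bool.toNat (Fin.insertNth (α := fun _ => Bool) 0 true y i)))
          rw [hsec]
          exact peelableNP_threshold n (t - 1)

/-- **THEOREM (comb form of the `F`-inequality for threshold third events).**  For all `n, t`, all monotone `A, B` on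
`Fin n → Bool` and the threshold event `G = {x : #{i : x i} ≥ t}` (majority for `n = 2t−1`; `G = ⊤` for `t = 0`, principal-free),
`#{x∈ABG} − #{x∈AG : x̄∈BG} − #{x∈G : x̄∈AB∖G} ≥ 0`.  Faces of thresholds are thresholds, so every tensor-Bernstein coefficient of
`F(A,B;G)` is `≥ 0` and `F(A,B;G) ≥ 0` for every product measure (memo; expansion not formalised here). [this work] -/
theorem comb_sum_nonneg_threshold (n t : ℕ) (A B : (Fin n → Bool) → Bool) (hA : Monotone A) (hB : Monotone B) :
    0 ≤ ∑ x : Fin n → Bool, (((Bool.toNat (A x && B x && decide (t ≤ ∑ i, Bool.toNat (x i))) : ℕ) : ℤ)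
          - ((Bool.toNat (A x && decide (t ≤ ∑ i, Bool.toNat (x i)) && B (fun i => !x i)
              && decide (t ≤ ∑ i, Bool.toNat ((fun i => !x i) i))) : ℕ) : ℤ)
          - ((Bool.toNat (decide (t ≤ ∑ i, Bool.toNat (x i)) && A (fun i => !x i) && B (fun i => !x i)
              && !(decide (t ≤ ∑ i, Bool.toNat ((fun i => !x i) i)))) : ℕ) : ℤ)) :=
  comb_sum_nonneg_of_peelableNP (peelableNP_threshold n t) A B hA hB

end SahiFComb

end Summit.CriticalPhenomena.PercolationContinuityZ3.Theorems
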